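import Mathlib
import HarnessLib
import HarnessLib.Audit
import Summits.HodgeConjecture.HodgeConjecture.Theses.KleimanBFSeeds
import Literature.AlgebraicGeometry.HodgeTheory.KodairaEmbeddingHyperplaneClass
import Literature.AlgebraicGeometry.HodgeTheory.KaehlerClass
import Literature.AlgebraicGeometry.HodgeTheory.RationalHodgeClasses

/-!
# Skeleton `Lines/kaehler-normal-form` for crux `KodairaHyperplaneClass` (stmt-HodgeConjecture-20272)

HONEST FRAMING: a crux PROOF SKELETON (cruxes-workfile class), not a proof. The crux
`Theses.KleimanBFSeeds.KodairaHyperplaneClass = Kodaira1954_rationalKaehlerClass_eq_hyperplaneClass` (Kodaira's embedding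
theorem in cohomological form: a rational class with a non-zero real Kähler multiple is the pull-back of a non-zero rational
class of `ℙᴺ` along some projective embedding; a refereed theorem typed as an open tree item — formalisation debt) is NOT
proved here: the `sorry`s sit exactly inside the registered `stub_*` declarations. Nothing here proves K-C⁺, H2, HC_AV or HC.

STRATEGY (line-writer seat `linewriter-hodgeav-h2sheaf` g0, 2026-08-31) — NORMAL FORM + CURVE RUNG:

* `stub_kodairaRationalKaehler` (load-bearing, XL) — the theorem proper in NORMAL FORM `s = 1`: a RATIONAL KÄHLER class `h`
  is the pull-back of a non-zero rational class along a projective embedding. Printed proof: `N • h` integral Kähler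
  (clear denominators) ⇒ `N • h = c₁(L)`, `L` positive (Lefschetz (1,1), [VoisinHodgeI2002] Thm. 11.30 / [Huybrechts2005]
  Prop. 3.3.2) ⇒ `L^{⊗m}` very ample (Kodaira, [Huybrechts2005] Prop. 5.3.1, [VoisinHodgeI2002] Thm. 7.11) ⇒ the embedding
  `φ : X ↪ ℙ(H⁰(L^m)^*)` is algebraic (Chow / GAGA, [SerreGAGA1956] §19) and `φ^*[H] = m N • h`; rescale.
  WHY NO FINER SPLIT IS TYPED: the intermediate objects — `c₁` of an algebraic line bundle IN BETTI COHOMOLOGY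
  `complexBetti X 2` (exponential sequence / first Chern class: Mathlib has no Chern classes; the tree's only typed carrier is
  the AXIOMATIC `ChernCharacterBetti`, whose existence is the open crux `ChernCharacterOnBetti`, stmt-19780, rung
  `stub_rung_firstChernClass` of `Cruxes/ChernCharacterOnBetti/Lines/grothendieck_axiomatic.lean`), ampleness / very ampleness
  and `ℙ(H⁰)` (Mathlib: no `AmpleLineBundle`, no sections-embedding), analytic-to-algebraic maps (GAGA) — are absent, so
  «Lefschetz (1,1) → positivity → Kodaira → pull-back formula» cannot be cut into typed stubs over existing declarations today.
* SIGN/SCALING REDUCTION (PROVED here, sorry-free, `isKaehlerClass_or_neg_of_smul`): if `s • h` is Kähler for a real `s ≠ 0`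
  then `h` or `-h` is Kähler (`IsKaehlerClass.smul_of_pos` with `|s|⁻¹`), and `-h = ((-1 : ℚ) : ℂ) • h` is rational; the
  composition rescales the rational class `a` on `ℙᴺ` by `-1` in the second case.
* `stub_rung_curves` — RUNG (special case, first prover target): the crux for CURVES (`n = 1`): `H²(C(ℂ); ℚ) ≅ ℚ`, every
  projective embedding restricts the hyperplane class to a class of positive degree, and a class with a Kähler multiple is
  non-zero — so the statement is decided by one-dimensionality, without Kodaira's theorem; outside the tree's proved regime
  (no Betti number of a curve, no degree of an embedding is in the tree). `rung_of_crux` (sorry-free) shows it IS a special case.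

COMPOSITION `KodairaHyperplaneClass_of` (sorry-free given the stub): case split on the sign reduction, the stub applied to
`h` resp. `((-1 : ℚ) : ℂ) • h`, and the rescaling of `a`.

References: [Kodaira1954]; [VoisinHodgeI2002] §7.1.3 Thm. 7.10, 7.11, §7.2.1 Thm. 7.14, Thm. 11.30; [Huybrechts2005]
Prop. 5.3.1, Cor. 5.3.3; [SerreGAGA1956] §19; [GriffithsHarris1978] §1.4 (curves: degree of the hyperplane class).
-/

-- every declaration of this problem lives in `Summit.HodgeConjecture.HodgeConjecture.…` (summit = sub-problem)
set_option linter.dupNamespace false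

noncomputable section

open CategoryTheory CategoryTheory.Limits AlgebraicGeometry
open Literature.AlgebraicGeometry.Motives Literature.AlgebraicGeometry.HodgeTheory
open Literature.AlgebraicTopology.SingularHomology

namespace Summit.HodgeConjecture.HodgeConjecture.Cruxes.KodairaHyperplaneClass.KaehlerNormalForm

/-- STUB (open, load-bearing, XL): Kodaira's theorem in NORMAL FORM — a rational KÄHLER class (`s = 1`) on a smooth
projective variety of positive dimension is the pull-back of a non-zero rational class of `ℙᴺ` along a projective embedding.
[cite: VoisinHodgeI2002, §7.1.3 Thm. 7.11 and §7.2.1 Thm. 7.14] [cite: Huybrechts2005, §5.3 Prop. 5.3.1 and Cor. 5.3.3]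
[cite: SerreGAGA1956, §19 Thm. 2–3] -/
theorem stub_kodairaRationalKaehler :
    ∀ ⦃n : ℕ⦄ ⦃X : SchemeOver ℂ⦄, IsSmoothProjective n X → 0 < n →
      ∀ (h : complexBetti X 2), IsRationalClass h → IsKaehlerClass n X h →
        ∃ (e : ProjectiveEmbedding X) (a : complexBetti (projectiveSpace e.n ℂ) 2),
          IsRationalClass a ∧ a ≠ 0 ∧ complexBetti.map e.ι 2 a = h := by
  sorry

/-- RUNG STUB (open, first prover target, M): the crux for CURVES (`n = 1`), decided in print by `b₂(C) = 1` and the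
positivity of the degree of a hyperplane section. [cite: GriffithsHarris1978, §1.4 (degree of a curve in ℙᴺ)]
[cite: VoisinHodgeI2002, §7.1.2 (Kähler classes are non-zero) and §11.3] -/
theorem stub_rung_curves :
    ∀ ⦃X : SchemeOver ℂ⦄, IsSmoothProjective 1 X →
      ∀ (h : complexBetti X 2), IsRationalClass h →
        (∃ s : ℝ, s ≠ 0 ∧ IsKaehlerClass 1 X ((s : ℂ) • h)) →
          ∃ (e : ProjectiveEmbedding X) (a : complexBetti (projectiveSpace e.n ℂ) 2),
            IsRationalClass a ∧ a ≠ 0 ∧ complexBetti.map e.ι 2 a = h := by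
  sorry

/-- Remark (sorry-free): the rung IS the crux at `n = 1`. -/
theorem rung_of_crux (hK : Summit.HodgeConjecture.HodgeConjecture.Theses.KleimanBFSeeds.KodairaHyperplaneClass) :
    ∀ ⦃X : SchemeOver ℂ⦄, IsSmoothProjective 1 X →
      ∀ (h : complexBetti X 2), IsRationalClass h →
        (∃ s : ℝ, s ≠ 0 ∧ IsKaehlerClass 1 X ((s : ℂ) • h)) →
          ∃ (e : ProjectiveEmbedding X) (a : complexBetti (projectiveSpace e.n ℂ) 2),
            IsRationalClass a ∧ a ≠ 0 ∧ complexBetti.map e.ι 2 a = h :=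
  fun _ hX h hh hs => hK hX one_pos h hh hs

/-- SIGN REDUCTION (proved): if a non-zero real multiple of `h` is Kähler then `h` or `-h` is Kähler.
[cite: VoisinHodgeI2002, §3.1.3 (positive multiples of Kähler forms)] -/
theorem isKaehlerClass_or_neg_of_smul {n : ℕ} {X : SchemeOver ℂ} {h : complexBetti X 2} {s : ℝ} (hs : s ≠ 0)
    (hK : IsKaehlerClass n X ((s : ℂ) • h)) :
    IsKaehlerClass n X h ∨ IsKaehlerClass n X (((-1 : ℚ) : ℂ) • h) := by
  rcases lt_or_gt_of_ne hs with hneg | hpos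
  · right
    have hc : 0 < -s⁻¹ := neg_pos.mpr (inv_lt_zero.mpr hneg)
    have := hK.smul_of_pos hc
    have hcoef : (((-s⁻¹ : ℝ) : ℂ) * (s : ℂ)) = ((-1 : ℚ) : ℂ) := by
      rw [Complex.ofReal_neg, Complex.ofReal_inv, neg_mul, inv_mul_cancel₀ (Complex.ofReal_ne_zero.mpr hs)]
      norm_num
    rw [smul_smul, hcoef] at this
    exact this
  · left
    have hc : 0 < s⁻¹ := inv_pos.mpr hpos
    have := hK.smul_of_pos hc
    have hcoef : (((s⁻¹ : ℝ) : ℂ) * (s : ℂ)) = 1 := by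
      rw [Complex.ofReal_inv]
      exact inv_mul_cancel₀ (Complex.ofReal_ne_zero.mpr hs)
    rw [smul_smul, hcoef, one_smul] at this
    exact this

/-- **Composition** (the ONLY theorem of this file concluding the crux): the normal-form stub gives
`KodairaHyperplaneClass` BY NAME (sign reduction + rescaling of the rational class on `ℙᴺ` by `-1`). -/
theorem KodairaHyperplaneClass_of :
    Summit.HodgeConjecture.HodgeConjecture.Theses.KleimanBFSeeds.KodairaHyperplaneClass := by
  intro n X hX hn h hh hs
  obtain ⟨s, hs0, hK⟩ := hs
  rcases isKaehlerClass_or_neg_of_smul hs0 hK with hK₁ | hK₂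
  · exact stub_kodairaRationalKaehler hX hn h hh hK₁
  · obtain ⟨e, a, ha, ha0, he⟩ := stub_kodairaRationalKaehler hX hn (((-1 : ℚ) : ℂ) • h) (hh.smul (-1)) hK₂
    refine ⟨e, ((-1 : ℚ) : ℂ) • a, ha.smul (-1), ?_, ?_⟩
    · exact smul_ne_zero (by norm_num) ha0
    · rw [map_smul, he, smul_smul]
      norm_num

end Summit.HodgeConjecture.HodgeConjecture.Cruxes.KodairaHyperplaneClass.KaehlerNormalForm

end
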